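import Summits.RiemannHypothesis.RiemannHypothesis.Theorems.SoloInformedMarkovBoundState
import Summits.RiemannHypothesis.RiemannHypothesis.Theorems.SoloInformedGroundStateNearNull

/-!
# Pieces for the margin of the bound-state count (solo programme, session 17)

Continuation of `SoloInformedMarkovBoundState.lean` and `SoloInformedGroundStateNearNull.lean`
(notation as there); the main theorem is in `SoloInformedMarkovMargin2.lean`. Everything here is
proved, with no hypothesis on the zeros. Contents:

* `integral_norm_sq_lin_of_disjoint`: `‖αw + βe‖₂² = |α|²‖w‖₂² + |β|²‖e‖₂²` for disjointly
  supported tests;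
* `weilMarkovQuadratic_plane_le` — **the plane estimate**: for pole-free `w` and a test `e` with
  `‖Q(e)‖ + P ≤ P(e)`, bounds `Re Q(w) ≤ Z` and `‖X‖, ‖Y‖ ≤ X₀` on the cross sums give
  `Q₀(αw + βe) ≤ |α|² (Z + X₀²/P)` for all `α, β ∈ ℂ` (`2 X₀|α||β| ≤ P|β|² + X₀²|α|²/P`);
* `exists_twoBump_threshold`: for a bump `u` with `û(0), û(1) > 0` and all large `b`, the pair
  `e_b = u(· − b) + u(· + b)` has `‖Q(e_b)‖ + û(0)û(1) e^{b} ≤ P(e_b)` (Tannery);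
* `exists_poleFree_nearNull` — **pole-free near-null vectors**: `w = k₂″ − k₂/4`,
  `k₂ = k_λ ⋆ m` (`k_λ = decayTest2 λ`, `m = moll 0`) is pole-free, lives on `|x| ≤ a(λ) + 1`,
  has `|ŵ(ρ)| ≤ ε 2^{-(M(λ)+1)}/(1+γ²)` at every non-trivial zero (the factor `|ρ(ρ−1)| ≤ 1+γ²`
  of the pole-killing operator is paid by the second mollifier), and `‖w‖₂² ≥ n > 0` uniformly.

References: E. Bombieri, "Remarks on Weil's quadratic functional in the theory of prime numbers
I", Rend. Mat. Acc. Lincei (9) 11 (2000) 183–233, Thm 2 (pole/Markov splitting); H. Yoshida,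
"On Hermitian forms attached to zeta functions", Adv. Stud. Pure Math. 21 (1992) 281–325, §6.
The estimates themselves are new.
-/

noncomputable section

open Complex Filter Set MeasureTheory
open scoped Real Topology ComplexConjugate

namespace Summit.RiemannHypothesis.RiemannHypothesis.Theorems

open Literature.NumberTheory.LFunctions Literature.NumberTheory.LFunctions.WeilConverse
  Literature.NumberTheory.LFunctions.WeilContinuous

/-! ## Elementary pieces -/

/-- Disjointly supported `w, e`: `‖α w + β e‖₂² = |α|² ‖w‖₂² + |β|² ‖e‖₂²`. [folklore] -/
theorem integral_norm_sq_lin_of_disjoint {w e : ℝ → ℂ} (hw : IsWeilTest w) (he : IsWeilTest e)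
    (hd : ∀ t, w t = 0 ∨ e t = 0) (α β : ℂ) :
    ∫ t, ‖α * w t + β * e t‖ ^ 2 = ‖α‖ ^ 2 * (∫ t, ‖w t‖ ^ 2) + ‖β‖ ^ 2 * ∫ t, ‖e t‖ ^ 2 := by
  have hpt : (fun t ↦ ‖α * w t + β * e t‖ ^ 2) =
      fun t ↦ ‖α‖ ^ 2 * ‖w t‖ ^ 2 + ‖β‖ ^ 2 * ‖e t‖ ^ 2 := by
    funext t
    rcases hd t with h | h <;> simp [h, mul_pow]
  have hi : ∀ {g : ℝ → ℂ}, IsWeilTest g → Integrable fun t ↦ ‖g t‖ ^ 2 := fun {g} hg ↦ by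
    have hgc : Continuous g := hg.1.continuous
    have hcont : Continuous fun t ↦ ‖g t‖ ^ 2 := by fun_prop
    exact hcont.integrable_of_hasCompactSupport
      (hg.2.norm.comp_left (g := fun x : ℝ ↦ x ^ 2) (by simp))
  rw [hpt, integral_add ((hi hw).const_mul _) ((hi he).const_mul _), integral_const_mul,
    integral_const_mul]

/-- `|s (s − 1)| ≤ 1 + (Im s)²` for `0 ≤ Re s ≤ 1`. [folklore] -/
theorem norm_mul_self_sub_one_le_strip {s : ℂ} (h0 : 0 ≤ s.re) (h1 : s.re ≤ 1) :
    ‖s * (s - 1)‖ ≤ 1 + s.im ^ 2 := by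
  rw [norm_mul]
  have hs : ‖s‖ ^ 2 = s.re ^ 2 + s.im ^ 2 := by
    rw [← Complex.normSq_eq_norm_sq, Complex.normSq_apply]; ring
  have hs1 : ‖s - 1‖ ^ 2 = (s.re - 1) ^ 2 + s.im ^ 2 := by
    rw [← Complex.normSq_eq_norm_sq, Complex.normSq_apply, Complex.sub_re, Complex.sub_im,
      Complex.one_re, Complex.one_im]; ring
  nlinarith [sq_nonneg (‖s‖ - ‖s - 1‖), norm_nonneg s, norm_nonneg (s - 1), mul_nonneg h0 h0]

/-- If `φ` vanishes on the open set `{R < |x|}`, so does `φ'' − φ/4`. [folklore] -/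
theorem poleKill_eq_zero {φ : ℝ → ℂ} {R : ℝ} (hφ : ∀ x : ℝ, R < |x| → φ x = 0) {x : ℝ}
    (hx : R < |x|) : (deriv (deriv φ) - fun t ↦ (4⁻¹ : ℂ) * φ t) x = 0 := by
  have hU : IsOpen {y : ℝ | R < |y|} := isOpen_lt continuous_const continuous_abs
  have h1 : ∀ y : ℝ, R < |y| → deriv φ y = 0 := fun y hy ↦ by
    have h : φ =ᶠ[𝓝 y] fun _ ↦ (0 : ℂ) :=
      Filter.eventually_of_mem (hU.mem_nhds hy) fun z hz ↦ hφ z hz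
    rw [h.deriv_eq, deriv_const]
  have h2 : deriv φ =ᶠ[𝓝 x] fun _ ↦ (0 : ℂ) :=
    Filter.eventually_of_mem (hU.mem_nhds hx) fun z hz ↦ h1 z hz
  have h3 : deriv (deriv φ) x = 0 := by rw [h2.deriv_eq, deriv_const]
  simp [h3, hφ x hx]

/-- `‖∑_ρ m(ρ) f(ρ)‖ ≤ K ∑_ρ m(ρ)/(1+γ²)²` when `‖f(ρ)‖ ≤ K/(1+γ²)²` on the zeros. [folklore] -/
theorem norm_zeroTsum_le {f : ℂ → ℂ} {K : ℝ}
    (hf : ∀ ρ ∈ ZetaZeros.riemannZetaNontrivialZeros, ‖f ρ‖ ≤ K / (1 + ρ.im ^ 2) ^ 2) :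
    ‖∑' ρ : ZetaZeros.riemannZetaNontrivialZeros, (riemannZetaZeroOrder (ρ : ℂ) : ℂ) * f ρ‖ ≤
      K * ∑' ρ : ZetaZeros.riemannZetaNontrivialZeros, weilZeroWeight (ρ : ℂ) := by
  have hs := summable_norm_zeroSide_of_le hf
  refine (norm_tsum_le_tsum_norm hs).trans ?_
  rw [← tsum_mul_left]
  refine hs.tsum_le_tsum (fun ρ ↦ ?_) (weilZeroSummable.mul_left K)
  have hm : (0 : ℝ) ≤ riemannZetaZeroOrder (ρ : ℂ) := by
    exact_mod_cast riemannZetaZeroOrder_nonneg (ZetaZeros.riemannZetaNontrivialZeros.ne_one ρ.2)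
  rw [norm_mul, Complex.norm_intCast, abs_of_nonneg hm, weilZeroWeight]
  calc (riemannZetaZeroOrder (ρ : ℂ) : ℝ) * ‖f ρ‖
      ≤ (riemannZetaZeroOrder (ρ : ℂ) : ℝ) * (K / (1 + (ρ : ℂ).im ^ 2) ^ 2) :=
        mul_le_mul_of_nonneg_left (hf ρ ρ.2) hm
    _ = K * ((riemannZetaZeroOrder (ρ : ℂ) : ℝ) / (1 + (ρ : ℂ).im ^ 2) ^ 2) := by ring

/-! ## The plane estimate -/

/-- **The plane estimate.** For pole-free `w` and a test `e` with `‖Q(e)‖ + P ≤ P(e)`, bounds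
`Re Q(w) ≤ Z` and `‖X‖, ‖Y‖ ≤ X₀` on the cross sums of the polarisation give
`Q₀(αw + βe) ≤ |α|² (Z + X₀²/P)` for all `α, β`: `2 X₀ |α||β| ≤ P|β|² + X₀²|α|²/P`. [new] -/
theorem weilMarkovQuadratic_plane_le {w e : ℝ → ℂ} (hw : IsWeilTest w) (he : IsWeilTest e)
    (hw0 : weilMellin w 0 = 0) (hw1 : weilMellin w 1 = 0) {Z X₀ P : ℝ} (hZ : (zeroForm w).re ≤ Z)
    (hX : ‖∑' ρ : ZetaZeros.riemannZetaNontrivialZeros, (riemannZetaZeroOrder (ρ : ℂ) : ℂ) *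
        (weilMellin w ρ * conj (weilMellin e (1 - conj (ρ : ℂ))))‖ ≤ X₀)
    (hY : ‖∑' ρ : ZetaZeros.riemannZetaNontrivialZeros, (riemannZetaZeroOrder (ρ : ℂ) : ℂ) *
        (weilMellin e ρ * conj (weilMellin w (1 - conj (ρ : ℂ))))‖ ≤ X₀)
    (hP : 0 < P) (hE : ‖zeroForm e‖ + P ≤ weilPoleForm e) (α β : ℂ) :
    weilMarkovQuadratic (fun t ↦ α * w t + β * e t) ≤ ‖α‖ ^ 2 * (Z + X₀ ^ 2 / P) := by
  have hv := isWeilTest_lin hw he α β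
  rw [weilMarkovQuadratic, ← combShapeDetection_zeroForm_eq_weilQuadratic hv, zeroForm_lin hw he,
    weilPoleForm_lin_of_poleFree hw he hw0 hw1]
  have h1 := re_polarised_le α β (zeroForm w)
    (∑' ρ : ZetaZeros.riemannZetaNontrivialZeros, (riemannZetaZeroOrder (ρ : ℂ) : ℂ) *
      (weilMellin w ρ * conj (weilMellin e (1 - conj (ρ : ℂ)))))
    (∑' ρ : ZetaZeros.riemannZetaNontrivialZeros, (riemannZetaZeroOrder (ρ : ℂ) : ℂ) *
      (weilMellin e ρ * conj (weilMellin w (1 - conj (ρ : ℂ))))) (zeroForm e)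
  have ha := norm_nonneg α
  have hb := norm_nonneg β
  have hZ' : ‖α‖ ^ 2 * (zeroForm w).re ≤ ‖α‖ ^ 2 * Z := mul_le_mul_of_nonneg_left hZ (sq_nonneg _)
  have hX' := mul_le_mul_of_nonneg_left hX (mul_nonneg ha hb)
  have hY' := mul_le_mul_of_nonneg_left hY (mul_nonneg ha hb)
  have hE' : ‖β‖ ^ 2 * ‖zeroForm e‖ ≤ ‖β‖ ^ 2 * (weilPoleForm e - P) :=
    mul_le_mul_of_nonneg_left (by linarith) (sq_nonneg _)
  have hy : 2 * X₀ * ‖α‖ * ‖β‖ - P * ‖β‖ ^ 2 ≤ ‖α‖ ^ 2 * (X₀ ^ 2 / P) := by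
    rw [mul_div_assoc', le_div_iff₀ hP]
    nlinarith [sq_nonneg (P * ‖β‖ - X₀ * ‖α‖)]
  linarith

/-! ## Two far bumps, quantitatively -/

/-- For a bump `u` with `û(0) = I₀ > 0`, `û(1) = I₁ > 0` and all large `b`:
`‖Q(e_b)‖ + I₀ I₁ e^{b} ≤ P(e_b)`, `e_b = u(· − b) + u(· + b)` — Tannery gives `Q(e_b) = o(e^{b})`
while `P(e_b) = 2 (e^{b/2} + e^{-b/2})² I₀ I₁ ≥ 2 I₀ I₁ e^{b}`. [new] -/
theorem exists_twoBump_threshold {u : ℝ → ℂ} (hu : IsWeilTest u) {I₀ I₁ : ℝ} (hI₀ : 0 < I₀)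
    (hI₁ : 0 < I₁) (hu0 : weilMellin u 0 = I₀) (hu1 : weilMellin u 1 = I₁) :
    ∃ b₀ : ℝ, 0 ≤ b₀ ∧ ∀ b : ℝ, b₀ ≤ b →
      ‖zeroForm (weilTranslate u b + weilTranslate u (-b))‖ + I₀ * I₁ * Real.exp b ≤
        weilPoleForm (weilTranslate u b + weilTranslate u (-b)) := by
  set E : ℝ → ℂ → ℂ := fun a s ↦ cexp ((s - 1 / 2) * a) + cexp ((s - 1 / 2) * ((-a : ℝ) : ℂ))
    with hE
  have hEb : ∀ a : ℝ, 0 ≤ a → ∀ ρ ∈ ZetaZeros.riemannZetaNontrivialZeros,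
      ‖E a ρ‖ ≤ 2 * Real.exp (|ρ.re - 1 / 2| * a) ∧
        ‖E a (1 - conj ρ)‖ ≤ 2 * Real.exp (|ρ.re - 1 / 2| * a) := by
    intro a ha ρ _
    refine ⟨norm_twoExp_le ρ ha, ?_⟩
    have h := norm_twoExp_le (1 - conj ρ) ha
    rwa [one_sub_conj_re, show |1 - ρ.re - 1 / 2| = |ρ.re - 1 / 2| by
      rw [abs_sub_comm]; ring_nf] at h
  have TE := tendsto_zeroSum_of_growth (θ := 1) (M := 4) one_pos (by norm_num)
    (c := fun s ↦ pairCoeff u s) (Φ := fun a s ↦ E a s * conj (E a (1 - conj s)))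
    (summable_norm_pairCoeff hu) fun a ha ρ hρ ↦ by
      rw [norm_mul, Complex.norm_conj, show 2 * (1 : ℝ) * |ρ.re - 1 / 2| * a =
        |ρ.re - 1 / 2| * a + |ρ.re - 1 / 2| * a by ring, Real.exp_add]
      have h0 : 0 ≤ Real.exp (|ρ.re - 1 / 2| * a) := (Real.exp_pos _).le
      nlinarith [(hEb a ha ρ hρ).1, (hEb a ha ρ hρ).2, norm_nonneg (E a ρ),
        norm_nonneg (E a (1 - conj ρ))]
  rw [NormedAddGroup.tendsto_nhds_zero] at TE
  obtain ⟨b₀, hb₀⟩ := Filter.eventually_atTop.1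
    ((eventually_ge_atTop (0 : ℝ)).and (TE (I₀ * I₁) (mul_pos hI₀ hI₁)))
  refine ⟨max b₀ 0, le_max_right _ _, fun b hb ↦ ?_⟩
  obtain ⟨-, hZ⟩ := hb₀ b ((le_max_left _ _).trans hb)
  have eZ : zeroForm (weilTranslate u b + weilTranslate u (-b)) =
      ∑' ρ : ZetaZeros.riemannZetaNontrivialZeros,
        (riemannZetaZeroOrder (ρ : ℂ) : ℂ) * pairCoeff u ρ *
          (E b ρ * conj (E b (1 - conj (ρ : ℂ)))) := by
    unfold zeroForm
    refine tsum_congr fun ρ ↦ ?_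
    rw [pairCoeff, pairCoeff, weilMellin_twoBump hu, weilMellin_twoBump hu, map_mul]
    ring
  have hn2 : ‖(Real.exp (-(1 * b)) : ℂ)‖ = Real.exp (-b) := by
    rw [Complex.norm_real, Real.norm_eq_abs, abs_of_pos (Real.exp_pos _)]; ring_nf
  have hi2 : Real.exp (-b) * Real.exp b = 1 := by rw [← Real.exp_add]; simp
  have hQ : ‖zeroForm (weilTranslate u b + weilTranslate u (-b))‖ ≤ I₀ * I₁ * Real.exp b := by
    rw [eZ]
    rw [norm_mul, hn2] at hZ
    nlinarith [hZ, Real.exp_pos b, norm_nonneg (∑' ρ : ZetaZeros.riemannZetaNontrivialZeros,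
        (riemannZetaZeroOrder (ρ : ℂ) : ℂ) * pairCoeff u ρ *
          (E b ρ * conj (E b (1 - conj (ρ : ℂ)))))]
  rw [weilPoleForm_twoBump hu hu0 hu1]
  nlinarith [mul_pos hI₀ hI₁, exp_le_twoCosh_sq b]

/-! ## Pole-free near-null vectors -/

/-- **Pole-free near-null vectors.** For `λ ≥ λ₁` the test `w = k₂'' − k₂/4`, `k₂ = k_λ ⋆ m`
(`k_λ = decayTest2 λ`, `m = moll 0`), is pole-free, vanishes for `|x| > a(λ) + 1`, has
`|ŵ(ρ)| ≤ ε 2^{-(M(λ)+1)}/(1+γ²)` at every non-trivial zero, and `‖w‖₂² ≥ n > 0` uniformly in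
`λ`. [new] -/
theorem exists_poleFree_nearNull :
    ∃ ε n lam₁ : ℝ, 0 ≤ ε ∧ 0 < n ∧ 1 ≤ lam₁ ∧ ∀ lam : ℝ, lam₁ ≤ lam → ∃ w : ℝ → ℂ,
      IsWeilTest w ∧ weilMellin w 0 = 0 ∧ weilMellin w 1 = 0 ∧
      (∀ x : ℝ, decayRadius lam + 1 < |x| → w x = 0) ∧
      (∀ ρ ∈ ZetaZeros.riemannZetaNontrivialZeros,
        ‖weilMellin w ρ‖ ≤ ε * (1 / 2 : ℝ) ^ (decayM lam + 1) / (1 + ρ.im ^ 2)) ∧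
      n ≤ ∫ t, ‖w t‖ ^ 2 := by
  obtain ⟨C, lam₁, hC0, hlam₁, hC⟩ := norm_weilMellin_decayTest2_le
  obtain ⟨c, lam₀, hc0, hlam₀, hc⟩ := norm_weilMellin_decayTest2_two_ge
  set D : ℝ := weilDecayConst (moll 0) with hD
  have hD0 : 0 ≤ D := weilDecayConst_nonneg _
  refine ⟨C * D, (2 * c * Real.exp (-(3 / 2 : ℝ))) ^ 2 / (64 * Real.exp 6), max lam₁ lam₀,
    by positivity, by positivity, hlam₁.trans (le_max_left _ _), fun lam hlam ↦ ?_⟩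
  have hl1 : lam₁ ≤ lam := (le_max_left _ _).trans hlam
  have hl0 : lam₀ ≤ lam := (le_max_right _ _).trans hlam
  have hlam1 : 1 ≤ lam := hlam₁.trans hl1
  have hlam0 : 0 < lam := by linarith
  have hk := isWeilTest_decayTest2 hlam0
  set k₂ : ℝ → ℂ := weilConv (decayTest2 lam) (moll 0) with hk₂def
  have hk₂ : IsWeilTest k₂ := isWeilTest_weilConv_moll hk.1.continuous hk.2 0
  have hk₂0 : ∀ x : ℝ, decayRadius lam + 1 < |x| → k₂ x = 0 := fun x hx ↦
    weilConv_moll_eq_zero (fun u hu ↦ decayTest2_eq_zero hlam0 hu) hx 0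
  have hk₂M : ∀ s : ℂ, weilMellin k₂ s = weilMellin (decayTest2 lam) s * weilMellin (moll 0) s :=
    fun s ↦ weilMellin_weilConv_moll hk.1.continuous hk.2 0 s
  have hR1 : 1 ≤ decayRadius lam := by
    unfold decayRadius
    linarith [Real.log_nonneg (by linarith : (1 : ℝ) ≤ lam + 1)]
  have hR0 : 0 < decayRadius lam + 1 := by linarith
  refine ⟨deriv (deriv k₂) - fun t ↦ (4⁻¹ : ℂ) * k₂ t, isWeilTest_poleKill hk₂,
    (poleFree_poleKill hk₂).1, (poleFree_poleKill hk₂).2, fun x hx ↦ poleKill_eq_zero hk₂0 hx,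
    fun ρ hρ ↦ ?_, ?_⟩
  · -- the transform at a zero
    obtain ⟨-, hre, hre1⟩ := mem_riemannZetaNontrivialZeros_iff_holds.1 hρ
    have hpos : 0 < 1 + ρ.im ^ 2 := by positivity
    have h12 : ‖weilMellin (decayTest2 lam) ρ * weilMellin (moll 0) ρ‖ ≤
        C * (1 / 2 : ℝ) ^ (decayM lam + 1) / (1 + ρ.im ^ 2) * (D / (1 + ρ.im ^ 2)) := by
      rw [norm_mul]
      exact mul_le_mul (hC lam hl1 ρ hρ) (norm_weilMellin_le (isWeilTest_moll 0) hre.le hre1.le)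
        (norm_nonneg _) (by positivity)
    rw [weilMellin_poleKill hk₂, hk₂M, norm_mul]
    calc ‖(ρ : ℂ) * (ρ - 1)‖ * ‖weilMellin (decayTest2 lam) ρ * weilMellin (moll 0) ρ‖
        ≤ (1 + ρ.im ^ 2) *
            (C * (1 / 2 : ℝ) ^ (decayM lam + 1) / (1 + ρ.im ^ 2) * (D / (1 + ρ.im ^ 2))) :=
          mul_le_mul (norm_mul_self_sub_one_le_strip hre.le hre1.le) h12 (norm_nonneg _) (by positivity)
      _ = C * D * (1 / 2 : ℝ) ^ (decayM lam + 1) / (1 + ρ.im ^ 2) := by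
          field_simp
  · -- the norm from below
    have hsupp : tsupport (deriv (deriv k₂) - fun t ↦ (4⁻¹ : ℂ) * k₂ t) ⊆
        Icc (-(decayRadius lam + 1)) (decayRadius lam + 1) := by
      refine closure_minimal (fun t ht ↦ ?_) isClosed_Icc
      by_contra habs
      refine ht (poleKill_eq_zero hk₂0 ?_)
      by_contra hle
      push Not at hle
      exact habs ⟨by linarith [neg_abs_le t], by linarith [le_abs_self t]⟩
    have hlow := integral_norm_sq_ge_of_support (isWeilTest_poleKill hk₂) hR0 hsupp
    have h22 : ‖(2 : ℂ) * (2 - 1)‖ = 2 := by norm_num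
    have h2 : 2 * c * Real.exp (-(3 / 2 : ℝ)) * lam ^ 2 ≤
        ‖weilMellin (deriv (deriv k₂) - fun t ↦ (4⁻¹ : ℂ) * k₂ t) 2‖ := by
      rw [weilMellin_poleKill hk₂, hk₂M, norm_mul, h22, norm_mul]
      calc 2 * c * Real.exp (-(3 / 2 : ℝ)) * lam ^ 2
          = 2 * ((c * lam ^ 2) * Real.exp (-(3 / 2 : ℝ))) := by ring
        _ ≤ 2 * (‖weilMellin (decayTest2 lam) 2‖ * ‖weilMellin (moll 0) 2‖) :=
          mul_le_mul_of_nonneg_left (mul_le_mul (hc lam hl0) norm_weilMellin_moll_zero_two_ge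
            (Real.exp_pos _).le (norm_nonneg _)) zero_le_two
    -- `2 (a(λ)+1) e^{3 (a(λ)+1)} ≤ 64 e^6 λ⁴`
    have hden : 2 * (decayRadius lam + 1) * Real.exp (3 * (decayRadius lam + 1)) ≤
        64 * Real.exp 6 * lam ^ 4 := by
      have e3 : Real.exp (3 * (decayRadius lam + 1)) =
          Real.exp (3 * decayRadius lam) * Real.exp 3 := by
        rw [← Real.exp_add]; ring_nf
      have e6 : Real.exp 6 = Real.exp 3 * Real.exp 3 := by
        rw [← Real.exp_add]; norm_num
      rw [e3, e6]
      have F1 := mul_le_mul_of_nonneg_right (decayRadius_mul_exp_le hlam1) (Real.exp_pos 3).le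
      have F2 := mul_nonneg (sub_nonneg.2 hR1)
        (mul_pos (Real.exp_pos (3 * decayRadius lam)) (Real.exp_pos 3)).le
      nlinarith [F1, F2]
    calc (2 * c * Real.exp (-(3 / 2 : ℝ))) ^ 2 / (64 * Real.exp 6)
        = (2 * c * Real.exp (-(3 / 2 : ℝ)) * lam ^ 2) ^ 2 / (64 * Real.exp 6 * lam ^ 4) := by
          rw [div_eq_div_iff (by positivity) (by positivity)]
          ring
      _ ≤ (2 * c * Real.exp (-(3 / 2 : ℝ)) * lam ^ 2) ^ 2 /
            (2 * (decayRadius lam + 1) * Real.exp (3 * (decayRadius lam + 1))) :=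
          div_le_div_of_nonneg_left (by positivity) (by positivity) hden
      _ = (2 * c * Real.exp (-(3 / 2 : ℝ)) * lam ^ 2) ^ 2 *
            (Real.exp (-(3 * (decayRadius lam + 1))) / (2 * (decayRadius lam + 1))) := by
          rw [Real.exp_neg]
          field_simp
          rw [← Real.exp_add, add_neg_cancel, Real.exp_zero]
      _ ≤ ‖weilMellin (deriv (deriv k₂) - fun t ↦ (4⁻¹ : ℂ) * k₂ t) 2‖ ^ 2 *
            (Real.exp (-(3 * (decayRadius lam + 1))) / (2 * (decayRadius lam + 1))) :=
          mul_le_mul_of_nonneg_right (pow_le_pow_left₀ (by positivity) h2 2) (by positivity)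
      _ ≤ _ := hlow

end Summit.RiemannHypothesis.RiemannHypothesis.Theorems
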